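import Literature.Geometry.Kaehler.RiemannSurfaceArcClosedForm
import Literature.Geometry.Kaehler.RiemannSurfaceHarmonic
import Literature.Geometry.Kaehler.PluriharmonicLog
import HarnessLib

/-!
# The logarithmic differential `(2πi)⁻¹ u⁻¹ du` of a nowhere-vanishing smooth function on a Riemann
# surface as a smooth closed complex `1`-form (Forster §9.9–9.13, §20.4–20.5)

Layer `Literature/Geometry/Kaehler`, sequel of `RiemannSurfaceOneFormsAsSmoothForms` (the forms
`a dz = oneZeroForm a`, `b dz̄ = zeroOneForm b`, their chart representatives `inChart_oneZeroForm` /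
`inChart_zeroOneForm`), `RiemannSurfaceChartCalculus` (Wirtinger derivatives in charts,
`d(P dz + Q dz̄) = (∂Q - ∂̄P) dz ∧ dz̄`, `mextDeriv_eq_zero_of_inChart_eventuallyEq`) and
`RiemannSurfaceArcClosedForm` §1 (the calculus of `∂ = delAlong 1`, `∂̄ = dbarAlong 1`).

O. Forster, *Lectures on Riemann Surfaces*, GTM 81 (1981): 9.9 «`df = ∂f/∂z dz + ∂f/∂z̄ dz̄`»,
9.13 «`dω = (∂g/∂z - ∂f/∂z̄) dz ∧ dz̄`» for `ω = f dz + g dz̄`, and §20.4–20.5, where for a weak solution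
`f` of a divisor the logarithmic differential `(2πi)⁻¹ f⁻¹ df` and its `(0,1)`-part
`σ = (2πi)⁻¹ f⁻¹ d″f` are the forms whose periods and pairings `(1/2πi) ∬ (df/f) ∧ ω = ∫_c ω` carry
the proof of Abel's theorem (Lemma 20.5, Theorem 20.7).  This file provides, for an arbitrary
nowhere-vanishing `u : M → ℂ` that is `C^∞` in the charts of a Riemann surface `M`, the form

  `logDerivForm u = P dz + Q dz̄`,  `P(x) = (2πi)⁻¹ u(x)⁻¹ ∂(u ∘ z_x⁻¹)(z_x x)`,
  `Q(x) = (2πi)⁻¹ u(x)⁻¹ ∂̄(u ∘ z_x⁻¹)(z_x x)`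

(coefficients in the preferred chart `z_x` at each point, the convention of the tree), and proves:

* §1 plane lemmas: the chain rules `∂(f ∘ h) = h′ · (∂f) ∘ h` for a holomorphic inner map and
  `∂(F ∘ h) = (F′ ∘ h) · ∂h` for a holomorphic outer map, `∂(conj ∘ u) = conj(∂̄u)`;
* §2 chart transport: smoothness in every preferred chart propagates along a chart
  (`contDiffAt_comp_symm_of_mem_target`), and `∂(u ∘ z_x⁻¹)(z_x x) = (z_p ∘ z_x⁻¹)′ · ∂(u ∘ z_p⁻¹)(z_p x)`
  (`delAlong_comp_chartAt_symm_eq`, companion of the tree's `dbarAlong_comp_chartAt_symm_eq`);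
* §3 `logDerivForm u`, its evaluation **`logDerivForm_apply`**
  (`(2πi)⁻¹ u(x)⁻¹ D(u ∘ z_x⁻¹)(z_x x)[w]`), `coeffZeroOne_logDerivForm`, the wedge
  `θ dz ∧ logDerivForm u = (θ Q) dz ∧ dz̄`, and its chart representative on a whole chart
  (**`inChart_logDerivForm`**: `(2πi)⁻¹ û⁻¹ ∂û dz + (2πi)⁻¹ û⁻¹ ∂̄û dz̄`, `û = u ∘ z_p⁻¹`);
* §4 **`isSmoothForm_logDerivForm`**;
* §5 **`isClosedForm_logDerivForm`** — near each point `û = exp ∘ ℓ` for a smooth local logarithm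
  `ℓ = log(û/û(z₀)) + log û(z₀)`, so the representative is `(2πi)⁻¹(∂ℓ dz + ∂̄ℓ dz̄) = (2πi)⁻¹ dℓ` and
  `∂∂̄ℓ = ∂̄∂ℓ` (9.13);
* §6 **`conj_logDerivForm_of_norm_eq_one`** — for `|u| = 1` the form is REAL (`conj Q = P`, from
  `∂(u ū) = 0`);
* §7 the unitisation `unitize u = u · e^{-log|u|} = u/|u|`: smooth, of modulus one, and
  **`logDerivForm_unitize`**: `logDerivForm (u/|u|) = logDerivForm u - (2πi)⁻¹ d(log |u|)`.

Everything is proved; the definitions (`logDerivCoeffZ`, `logDerivCoeffZbar`, `logDerivForm`,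
`unitize`) have bodies; no instances, no named facts.

## References

* O. Forster, *Lectures on Riemann Surfaces*, GTM 81, Springer (1981), §9.9, §9.11, §9.13, §20.4,
  Lemma 20.5, Theorem 20.7 (proof). [Forster1981]
* L. Hörmander, *An Introduction to Complex Analysis in Several Variables* (1973), §1.1 (the operators
  `∂/∂z`, `∂/∂z̄`). [HormanderSCV1973]
* R. Miranda, *Algebraic Curves and Riemann Surfaces*, GSM 5 (1995), Chapter IV Definitions 1.2, 1.7
  (transformation of local expressions). [Miranda1995]
-/

noncomputable section

open scoped Manifold ContDiff Topology ComplexConjugate Real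
open Set Filter Function Complex Metric
open Literature.NumberTheory.Transcendental Literature.Analysis.Complex

namespace Literature.Geometry.Kaehler

/-! ### §1 Plane lemmas: chain rules for `∂`, and `∂(ū) = conj(∂̄u)` -/

section Plane

/-- **Chain rule for `∂` with a holomorphic inner map**: `∂(f ∘ h)(w) = h′(w) · (∂f)(h w)` for `h`
complex-differentiable at `w` and `f` real-differentiable at `h w` (a `(1,0)`-coefficient transforms
with the derivative of a holomorphic change of variable). [cite: HormanderSCV1973, §1.1] -/
theorem delAlong_one_comp_of_hasDerivAt {f : ℂ → ℂ} {h : ℂ → ℂ} {h' w : ℂ}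
    (hh : HasDerivAt h h' w) (hf : DifferentiableAt ℝ f (h w)) :
    delAlong 1 (fun y ↦ f (h y)) w = h' * delAlong 1 f (h w) := by
  have H : HasFDerivAt (fun y ↦ f (h y))
      ((fderiv ℝ f (h w)).comp ((ContinuousLinearMap.smulRight (1 : ℂ →L[ℂ] ℂ) h').restrictScalars ℝ)) w :=
    hf.hasFDerivAt.comp w (hh.hasFDerivAt.restrictScalars ℝ)
  rw [delAlong_apply, H.fderiv]
  simp only [ContinuousLinearMap.comp_apply, ContinuousLinearMap.coe_restrictScalars',
    ContinuousLinearMap.smulRight_apply, one_apply_eq_self, smul_eq_mul, one_mul,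
    fderiv_apply_eq_delAlong_add_dbarAlong f (h w), map_mul, conj_I, map_one]
  linear_combination ((1 : ℂ) / 2 * (dbarAlong 1 f (h w) * conj h' - delAlong 1 f (h w) * h')) * I_sq

/-- **Chain rule for `∂` with a holomorphic outer map**: `∂(F ∘ h)(w) = F′(h w) · ∂h(w)`.
[cite: HormanderSCV1973, §1.1] -/
theorem delAlong_one_comp_of_differentiableAt {F h : ℂ → ℂ} {w : ℂ}
    (hF : DifferentiableAt ℂ F (h w)) (hh : DifferentiableAt ℝ h w) :
    delAlong 1 (fun y ↦ F (h y)) w = deriv F (h w) * delAlong 1 h w := by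
  have H : HasFDerivAt (fun y ↦ F (h y)) (deriv F (h w) • fderiv ℝ h w) w :=
    hF.hasDerivAt.comp_hasFDerivAt w hh.hasFDerivAt
  rw [delAlong_apply, delAlong_apply, H.fderiv]
  simp only [smul_apply, smul_eq_mul]
  ring

/-- `∂(conj ∘ u) = conj(∂̄ u)` for `u` real-differentiable at the point. [cite: HormanderSCV1973, §1.1] -/
theorem delAlong_one_conj_comp {u : ℂ → ℂ} {w : ℂ} (hu : DifferentiableAt ℝ u w) :
    delAlong 1 (fun y ↦ conj (u y)) w = conj (dbarAlong 1 u w) := by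
  have H : HasFDerivAt (fun y ↦ conj (u y)) ((conjCLE : ℂ →L[ℝ] ℂ).comp (fderiv ℝ u w)) w :=
    (conjCLE : ℂ →L[ℝ] ℂ).hasFDerivAt.comp w hu.hasFDerivAt
  rw [delAlong_apply, dbarAlong_one, H.fderiv]
  simp only [ContinuousLinearMap.comp_apply, ContinuousLinearEquiv.coe_coe, conjCLE_apply, smul_eq_mul,
    map_mul, map_add, map_inv₀, map_ofNat, conj_I, mul_one]
  ring

/-- `∂` of a product with a constant on the right: `∂(a · c) = (∂a) c`. [cite: HormanderSCV1973, §1.1] -/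
theorem delAlong_mul_const {a : ℂ → ℂ} {z : ℂ} (ha : DifferentiableAt ℝ a z) (c : ℂ) :
    delAlong 1 (fun w ↦ a w * c) z = delAlong 1 a z * c := by
  rw [show (fun w ↦ a w * c) = fun w ↦ c * a w from funext fun w ↦ mul_comm _ _, delAlong_const_mul ha,
    mul_comm]

end Plane

namespace RiemannSurface

variable {M : Type*} [TopologicalSpace M] [ChartedSpace ℂ M]

/-! ### §2 Chart transport of smoothness and of `∂` -/

section Charts

variable [IsManifold 𝓘(ℂ, ℂ) ω M]

omit [IsManifold 𝓘(ℂ, ℂ) ω M] in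
/-- Near a point `y` of the target of `z_p`, `u ∘ z_p⁻¹ = (u ∘ z_{x'}⁻¹) ∘ (z_{x'} ∘ z_p⁻¹)` with
`x' = z_p⁻¹ y`. [cite: Miranda1995, Chapter IV Definition 1.2] -/
theorem comp_symm_eventuallyEq_comp_transition (u : M → ℂ) {p : M} {y : ℂ} (hy : y ∈ (chartAt ℂ p).target) :
    u ∘ (chartAt ℂ p).symm =ᶠ[𝓝 y]
      (u ∘ (chartAt ℂ ((chartAt ℂ p).symm y)).symm) ∘ (chartAt ℂ ((chartAt ℂ p).symm y) ∘ (chartAt ℂ p).symm) := by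
  set x' := (chartAt ℂ p).symm y with hx'
  have h1 : ∀ᶠ z in 𝓝 y, (chartAt ℂ p).symm z ∈ (chartAt ℂ x').source :=
    ((chartAt ℂ p).continuousAt_symm hy).eventually ((chartAt ℂ x').open_source.mem_nhds (mem_chart_source ℂ x'))
  filter_upwards [h1] with z hz
  simp only [comp_apply, (chartAt ℂ x').left_inv hz]

/-- **Smoothness in the preferred charts propagates along every chart**: if `u ∘ z_x⁻¹` is `C^∞` at
`z_x x` for every `x`, then `u ∘ z_p⁻¹` is `C^∞` at every point of the target of `z_p` (the transition
maps are analytic). [cite: Forster1981, §9.8] -/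
theorem contDiffAt_comp_symm_of_mem_target {u : M → ℂ}
    (hu : ∀ x, ContDiffAt ℝ ∞ (u ∘ (chartAt ℂ x).symm) (chartAt ℂ x x)) {p : M} {y : ℂ}
    (hy : y ∈ (chartAt ℂ p).target) : ContDiffAt ℝ ∞ (u ∘ (chartAt ℂ p).symm) y := by
  set x' := (chartAt ℂ p).symm y with hx'
  have hT : AnalyticAt ℂ (chartAt ℂ x' ∘ (chartAt ℂ p).symm) y :=
    analyticAt_atlas_transition (chart_mem_atlas ℂ p) (chart_mem_atlas ℂ x') hy (mem_chart_source ℂ x')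
  have hT' : ContDiffAt ℝ ∞ (chartAt ℂ x' ∘ (chartAt ℂ p).symm) y := (hT.contDiffAt.of_le le_top).restrict_scalars ℝ
  have hTy : (chartAt ℂ x' ∘ (chartAt ℂ p).symm) y = chartAt ℂ x' x' := rfl
  have hux : ContDiffAt ℝ ∞ (u ∘ (chartAt ℂ x').symm) ((chartAt ℂ x' ∘ (chartAt ℂ p).symm) y) := by
    rw [hTy]; exact hu x'
  exact (hux.comp y hT').congr_of_eventuallyEq (comp_symm_eventuallyEq_comp_transition u hy)

/-- Differentiable version of `contDiffAt_comp_symm_of_mem_target`. [cite: Forster1981, §9.8] -/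
theorem differentiableAt_comp_symm_of_mem_target {u : M → ℂ}
    (hu : ∀ x, ContDiffAt ℝ ∞ (u ∘ (chartAt ℂ x).symm) (chartAt ℂ x x)) {p : M} {y : ℂ}
    (hy : y ∈ (chartAt ℂ p).target) : DifferentiableAt ℝ (u ∘ (chartAt ℂ p).symm) y :=
  (contDiffAt_comp_symm_of_mem_target hu hy).differentiableAt (by simp)

/-- **Change of chart for `∂u`**: for `x` in the source of `z_p` and `u ∘ z_p⁻¹` real-differentiable at
`z_p x`, `∂(u ∘ z_x⁻¹)(z_x x) = (z_p ∘ z_x⁻¹)′(z_x x) · ∂(u ∘ z_p⁻¹)(z_p x)` (a `(1,0)`-coefficient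
transforms with the derivative of the holomorphic transition map; companion of
`dbarAlong_comp_chartAt_symm_eq`). [cite: Forster1981, §9.9] [cite: Miranda1995, Chapter IV Definition 1.7] -/
theorem delAlong_comp_chartAt_symm_eq {u : M → ℂ} {p x : M} (hx : x ∈ (chartAt ℂ p).source)
    (hu : DifferentiableAt ℝ (u ∘ (chartAt ℂ p).symm) (chartAt ℂ p x)) :
    delAlong 1 (u ∘ (chartAt ℂ x).symm) (chartAt ℂ x x) =
      deriv (chartAt ℂ p ∘ (chartAt ℂ x).symm) (chartAt ℂ x x) *
        delAlong 1 (u ∘ (chartAt ℂ p).symm) (chartAt ℂ p x) := by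
  set T : ℂ → ℂ := chartAt ℂ p ∘ (chartAt ℂ x).symm with hT
  have hTx : T (chartAt ℂ x x) = chartAt ℂ p x := by
    simp [hT, (chartAt ℂ x).left_inv (mem_chart_source ℂ x)]
  have hev : u ∘ (chartAt ℂ x).symm =ᶠ[𝓝 (chartAt ℂ x x)] (u ∘ (chartAt ℂ p).symm) ∘ T := by
    have h1 : ∀ᶠ z in 𝓝 (chartAt ℂ x x), (chartAt ℂ x).symm z ∈ (chartAt ℂ p).source := by
      refine (chartAt ℂ x).continuousAt_symm (mem_chart_target ℂ x) |>.eventually ?_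
      rw [(chartAt ℂ x).left_inv (mem_chart_source ℂ x)]
      exact (chartAt ℂ p).open_source.mem_nhds hx
    filter_upwards [h1] with z hz
    simp only [hT, comp_apply, (chartAt ℂ p).left_inv hz]
  have hTd : HasDerivAt T (deriv T (chartAt ℂ x x)) (chartAt ℂ x x) :=
    (differentiableAt_coordChange (mdifferentiableOn_atlas (I := 𝓘(ℂ, ℂ)) (chart_mem_atlas ℂ p))
      (mdifferentiableOn_atlas_symm (I := 𝓘(ℂ, ℂ)) (chart_mem_atlas ℂ x)) (mem_chart_target ℂ x)
      (by rw [(chartAt ℂ x).left_inv (mem_chart_source ℂ x)]; exact hx)).hasDerivAt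
  have hu' : DifferentiableAt ℝ (u ∘ (chartAt ℂ p).symm) (T (chartAt ℂ x x)) := by rwa [hTx]
  rw [delAlong_congr_of_eventuallyEq hev, comp_def, delAlong_one_comp_of_hasDerivAt hTd hu', hTx]

end Charts

/-! ### §3 The logarithmic differential `(2πi)⁻¹ u⁻¹ du = P dz + Q dz̄` -/

section Form

/-- The `dz_x`-coefficient `P(x) = (2πi)⁻¹ u(x)⁻¹ ∂(u ∘ z_x⁻¹)(z_x x)` of the logarithmic differential
of `u` (Forster 9.9: `d′f = ∂f/∂z dz`). [cite: Forster1981, §9.9 and §20.4] -/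
def logDerivCoeffZ (u : M → ℂ) (x : M) : ℂ :=
  (2 * π * I)⁻¹ * ((u x)⁻¹ * delAlong 1 (u ∘ (chartAt ℂ x).symm) (chartAt ℂ x x))

/-- The `dz̄_x`-coefficient `Q(x) = (2πi)⁻¹ u(x)⁻¹ ∂̄(u ∘ z_x⁻¹)(z_x x)` of the logarithmic differential
(Forster's `σ = (2πi)⁻¹ f⁻¹ d″f`). [cite: Forster1981, §9.9 and Lemma 20.5] -/
def logDerivCoeffZbar (u : M → ℂ) (x : M) : ℂ :=
  (2 * π * I)⁻¹ * ((u x)⁻¹ * dbarAlong 1 (u ∘ (chartAt ℂ x).symm) (chartAt ℂ x x))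

/-- **The logarithmic differential `(2πi)⁻¹ u⁻¹ du = P dz + Q dz̄`** of a function `u : M → ℂ` as a
complex `1`-form on the Riemann surface. [cite: Forster1981, §9.9 and Lemma 20.5] -/
def logDerivForm (u : M → ℂ) : MForm 𝓘(ℝ, ℂ) M ℂ 1 :=
  oneZeroForm (logDerivCoeffZ u) + zeroOneForm (logDerivCoeffZbar u)

/-- Unfolding `logDerivForm`. [cite: Forster1981, §9.9] -/
theorem logDerivForm_eq (u : M → ℂ) :
    logDerivForm u = oneZeroForm (logDerivCoeffZ u) + zeroOneForm (logDerivCoeffZbar u) := rfl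

/-- Unfolding `logDerivCoeffZ`. [cite: Forster1981, §9.9] -/
theorem logDerivCoeffZ_apply (u : M → ℂ) (x : M) :
    logDerivCoeffZ u x = (2 * π * I)⁻¹ * ((u x)⁻¹ * delAlong 1 (u ∘ (chartAt ℂ x).symm) (chartAt ℂ x x)) := rfl

/-- Unfolding `logDerivCoeffZbar`. [cite: Forster1981, §9.9] -/
theorem logDerivCoeffZbar_apply (u : M → ℂ) (x : M) :
    logDerivCoeffZbar u x = (2 * π * I)⁻¹ * ((u x)⁻¹ * dbarAlong 1 (u ∘ (chartAt ℂ x).symm) (chartAt ℂ x x)) :=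
  rfl

/-- The `dz̄`-coefficient of the logarithmic differential is `Q`. [cite: Forster1981, §9.9] -/
@[simp] theorem coeffZeroOne_logDerivForm (u : M → ℂ) : coeffZeroOne (logDerivForm u) = logDerivCoeffZbar u := by
  rw [logDerivForm, coeffZeroOne_add, coeffZeroOne_oneZeroForm, coeffZeroOne_zeroOneForm, zero_add]

/-- The `dz`-coefficient of the logarithmic differential is `P`. [cite: Forster1981, §9.9] -/
@[simp] theorem coeffOneZero_logDerivForm (u : M → ℂ) : coeffOneZero (logDerivForm u) = logDerivCoeffZ u := by
  rw [logDerivForm, coeffOneZero_add, coeffOneZero_oneZeroForm, coeffOneZero_zeroOneForm, add_zero]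

/-- **Evaluation: `((2πi)⁻¹ u⁻¹ du)_x(w) = (2πi)⁻¹ u(x)⁻¹ D(u ∘ z_x⁻¹)(z_x x)[w]`** (Forster 9.9:
`df = ∂f dz + ∂̄f dz̄`, i.e. `Df[w] = ∂f w + ∂̄f w̄`). [cite: Forster1981, §9.9] -/
theorem logDerivForm_apply (u : M → ℂ) (x : M) (v : Fin 1 → TangentSpace 𝓘(ℝ, ℂ) x) :
    logDerivForm u x v = (2 * π * I)⁻¹ * ((u x)⁻¹ *
      fderiv ℝ (u ∘ (chartAt ℂ x).symm) (chartAt ℂ x x) (v 0)) := by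
  simp only [logDerivForm, Pi.add_apply, ContinuousAlternatingMap.add_apply, oneZeroForm_apply,
    zeroOneForm_apply, logDerivCoeffZ, logDerivCoeffZbar, fderiv_apply_eq_delAlong_add_dbarAlong]
  ring

/-- **`θ dz ∧ (2πi)⁻¹ u⁻¹ du = (θ Q) dz ∧ dz̄`**: only the `(0,1)`-part of the logarithmic differential
pairs with a `(1,0)`-form. [cite: Forster1981, Lemma 20.5] -/
theorem oneZeroForm_wedge_logDerivForm (θ : M → ℂ) (u : M → ℂ) :
    (oneZeroForm θ).wedge (logDerivForm u) = oneOneForm (θ * logDerivCoeffZbar u) := by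
  rw [oneZeroForm_wedge, coeffZeroOne_logDerivForm]

variable [IsManifold 𝓘(ℂ, ℂ) ω M]

/-- The local expression of `P` in a chart `z_p`: at `y = z_p x'`,
`P_{z_p}(y) = (2πi)⁻¹ û(y)⁻¹ ∂û(y)` with `û = u ∘ z_p⁻¹` (the transition derivatives cancel:
`(z_p∘z_{x'}⁻¹)′ (z_{x'}∘z_p⁻¹)′ = 1`). [cite: Miranda1995, Chapter IV Definition 1.7] [cite: Forster1981, §9.9] -/
theorem localExpr_logDerivCoeffZ {u : M → ℂ} {p : M} {y : ℂ} (hy : y ∈ (chartAt ℂ p).target)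
    (hu : DifferentiableAt ℝ (u ∘ (chartAt ℂ p).symm) y) :
    localExpr (logDerivCoeffZ u) (chartAt ℂ p) y =
      (2 * π * I)⁻¹ * ((u ((chartAt ℂ p).symm y))⁻¹ * delAlong 1 (u ∘ (chartAt ℂ p).symm) y) := by
  set x' := (chartAt ℂ p).symm y with hx'
  have hx's : x' ∈ (chartAt ℂ p).source := (chartAt ℂ p).map_target hy
  have hpy : chartAt ℂ p x' = y := (chartAt ℂ p).right_inv hy
  have hu' : DifferentiableAt ℝ (u ∘ (chartAt ℂ p).symm) (chartAt ℂ p x') := by rwa [hpy]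
  rw [localExpr_apply, logDerivCoeffZ_apply, delAlong_comp_chartAt_symm_eq hx's hu', hpy]
  have h1 := deriv_chartAt_comp_symm_mul_deriv hx's
  rw [hpy] at h1
  calc (2 * π * I)⁻¹ * ((u x')⁻¹ * (deriv (chartAt ℂ p ∘ (chartAt ℂ x').symm) (chartAt ℂ x' x') *
        delAlong 1 (u ∘ (chartAt ℂ p).symm) y)) * deriv (chartAt ℂ x' ∘ (chartAt ℂ p).symm) y
      = (2 * π * I)⁻¹ * ((u x')⁻¹ * delAlong 1 (u ∘ (chartAt ℂ p).symm) y) *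
        (deriv (chartAt ℂ p ∘ (chartAt ℂ x').symm) (chartAt ℂ x' x') *
          deriv (chartAt ℂ x' ∘ (chartAt ℂ p).symm) y) := by ring
    _ = _ := by rw [h1, mul_one]

/-- The (conjugated) local expression of `Q` in a chart `z_p`:
`conj((conj Q)_{z_p}(y)) = (2πi)⁻¹ û(y)⁻¹ ∂̄û(y)`. [cite: Miranda1995, Chapter IV Definition 1.7] [cite: Forster1981, §9.9] -/
theorem conj_localExpr_star_logDerivCoeffZbar {u : M → ℂ} {p : M} {y : ℂ} (hy : y ∈ (chartAt ℂ p).target)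
    (hu : DifferentiableAt ℝ (u ∘ (chartAt ℂ p).symm) y) :
    conj (localExpr (star (logDerivCoeffZbar u)) (chartAt ℂ p) y) =
      (2 * π * I)⁻¹ * ((u ((chartAt ℂ p).symm y))⁻¹ * dbarAlong 1 (u ∘ (chartAt ℂ p).symm) y) := by
  set x' := (chartAt ℂ p).symm y with hx'
  have hx's : x' ∈ (chartAt ℂ p).source := (chartAt ℂ p).map_target hy
  have hpy : chartAt ℂ p x' = y := (chartAt ℂ p).right_inv hy
  have hu' : DifferentiableAt ℝ (u ∘ (chartAt ℂ p).symm) (chartAt ℂ p x') := by rwa [hpy]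
  rw [localExpr_apply, Pi.star_apply, RCLike.star_def, map_mul, conj_conj, logDerivCoeffZbar_apply,
    dbarAlong_comp_chartAt_symm_eq hx's hu', hpy]
  have h1 := deriv_chartAt_comp_symm_mul_deriv hx's
  rw [hpy] at h1
  have h1' : conj (deriv (chartAt ℂ p ∘ (chartAt ℂ x').symm) (chartAt ℂ x' x')) *
      conj (deriv (chartAt ℂ x' ∘ (chartAt ℂ p).symm) y) = 1 := by
    rw [← map_mul, h1, map_one]
  calc (2 * π * I)⁻¹ * ((u x')⁻¹ * (conj (deriv (chartAt ℂ p ∘ (chartAt ℂ x').symm) (chartAt ℂ x' x')) *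
        dbarAlong 1 (u ∘ (chartAt ℂ p).symm) y)) * conj (deriv (chartAt ℂ x' ∘ (chartAt ℂ p).symm) y)
      = (2 * π * I)⁻¹ * ((u x')⁻¹ * dbarAlong 1 (u ∘ (chartAt ℂ p).symm) y) *
        (conj (deriv (chartAt ℂ p ∘ (chartAt ℂ x').symm) (chartAt ℂ x' x')) *
          conj (deriv (chartAt ℂ x' ∘ (chartAt ℂ p).symm) y)) := by ring
    _ = _ := by rw [h1', mul_one]

/-- **The chart representative of the logarithmic differential on a whole chart**: at every point
`y` of the target of `z_p` where `û = u ∘ z_p⁻¹` is real-differentiable,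
`((2πi)⁻¹ u⁻¹ du)^_{z_p}(y) = (2πi)⁻¹ û(y)⁻¹ ∂û(y) dz + (2πi)⁻¹ û(y)⁻¹ ∂̄û(y) dz̄`.
[cite: Forster1981, §9.9] [cite: Miranda1995, Chapter IV Definition 1.7] -/
theorem inChart_logDerivForm [IsManifold 𝓘(ℝ, ℂ) ∞ M] {u : M → ℂ} {p : M} {y : ℂ} (hy : y ∈ (chartAt ℂ p).target)
    (hu : DifferentiableAt ℝ (u ∘ (chartAt ℂ p).symm) y) :
    (logDerivForm u).inChart p y =
      ((2 * π * I)⁻¹ * ((u ((chartAt ℂ p).symm y))⁻¹ * delAlong 1 (u ∘ (chartAt ℂ p).symm) y)) • dzForm +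
      ((2 * π * I)⁻¹ * ((u ((chartAt ℂ p).symm y))⁻¹ * dbarAlong 1 (u ∘ (chartAt ℂ p).symm) y)) • dzbarForm := by
  rw [logDerivForm, MForm.inChart_add]
  show (oneZeroForm (logDerivCoeffZ u)).inChart p y + (zeroOneForm (logDerivCoeffZbar u)).inChart p y = _
  rw [inChart_oneZeroForm _ hy, inChart_zeroOneForm _ hy, localExpr_logDerivCoeffZ hy hu,
    conj_localExpr_star_logDerivCoeffZbar hy hu]

end Form

/-! ### §4 Smoothness -/

section Smooth

variable [IsManifold 𝓘(ℂ, ℂ) ω M] [IsManifold 𝓘(ℝ, ℂ) ∞ M]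

/-- `y ↦ ∂û(y)` is `C^∞` at a point where `û` is. [cite: HormanderSCV1973, §1.1] -/
theorem contDiffAt_delAlong_one {û : ℂ → ℂ} {y : ℂ} (h : ContDiffAt ℝ ∞ û y) :
    ContDiffAt ℝ ∞ (delAlong 1 û) y := by
  have hD : ContDiffAt ℝ ∞ (fderiv ℝ û) y := h.fderiv_right (m := ∞) (by simp)
  have h1 : ContDiffAt ℝ ∞ (fun z ↦ fderiv ℝ û z 1) y := hD.clm_apply contDiffAt_const
  have hI : ContDiffAt ℝ ∞ (fun z ↦ fderiv ℝ û z I) y := hD.clm_apply contDiffAt_const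
  have : delAlong 1 û = fun z ↦ (2 : ℂ)⁻¹ • (fderiv ℝ û z 1 - I • fderiv ℝ û z (I • 1)) :=
    funext fun z ↦ delAlong_apply 1 û z
  rw [this]
  simp only [smul_eq_mul, mul_one]
  exact contDiffAt_const.mul (h1.sub (contDiffAt_const.mul hI))

/-- `y ↦ ∂̄û(y)` is `C^∞` at a point where `û` is. [cite: HormanderSCV1973, §1.1] -/
theorem contDiffAt_dbarAlong_one {û : ℂ → ℂ} {y : ℂ} (h : ContDiffAt ℝ ∞ û y) :
    ContDiffAt ℝ ∞ (dbarAlong 1 û) y := by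
  have hD : ContDiffAt ℝ ∞ (fderiv ℝ û) y := h.fderiv_right (m := ∞) (by simp)
  have h1 : ContDiffAt ℝ ∞ (fun z ↦ fderiv ℝ û z 1) y := hD.clm_apply contDiffAt_const
  have hI : ContDiffAt ℝ ∞ (fun z ↦ fderiv ℝ û z I) y := hD.clm_apply contDiffAt_const
  have : dbarAlong 1 û = fun z ↦ (2 : ℂ)⁻¹ • (fderiv ℝ û z 1 + I • fderiv ℝ û z I) :=
    funext fun z ↦ dbarAlong_one û z
  rw [this]
  simp only [smul_eq_mul]
  exact contDiffAt_const.mul (h1.add (contDiffAt_const.mul hI))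

/-- The function `y ↦ (2πi)⁻¹ û(y)⁻¹ ∂û(y)` is `C^∞` near a point where `û` is `C^∞` and non-zero.
[cite: HormanderSCV1973, §1.1] -/
theorem contDiffAt_inv_mul_delAlong {û : ℂ → ℂ} {y : ℂ} (h : ContDiffAt ℝ ∞ û y) (h0 : û y ≠ 0) :
    ContDiffAt ℝ ∞ (fun z ↦ (2 * π * I)⁻¹ * ((û z)⁻¹ * delAlong 1 û z)) y :=
  contDiffAt_const.mul ((h.inv h0).mul (contDiffAt_delAlong_one h))

/-- The function `y ↦ (2πi)⁻¹ û(y)⁻¹ ∂̄û(y)` is `C^∞` near a point where `û` is `C^∞` and non-zero.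
[cite: HormanderSCV1973, §1.1] -/
theorem contDiffAt_inv_mul_dbarAlong {û : ℂ → ℂ} {y : ℂ} (h : ContDiffAt ℝ ∞ û y) (h0 : û y ≠ 0) :
    ContDiffAt ℝ ∞ (fun z ↦ (2 * π * I)⁻¹ * ((û z)⁻¹ * dbarAlong 1 û z)) y :=
  contDiffAt_const.mul ((h.inv h0).mul (contDiffAt_dbarAlong_one h))

/-- **The logarithmic differential of a nowhere-vanishing chart-smooth function is a smooth form**
(Forster 9.8: smoothness is smoothness of the coefficients in charts).
[cite: Forster1981, §9.8 and §9.9] -/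
theorem isSmoothForm_logDerivForm {u : M → ℂ}
    (hu : ∀ x, ContDiffAt ℝ ∞ (u ∘ (chartAt ℂ x).symm) (chartAt ℂ x x)) (h0 : ∀ x, u x ≠ 0) :
    IsSmoothForm (logDerivForm u) := by
  have hP : IsSmoothForm (oneZeroForm (logDerivCoeffZ u)) := by
    refine isSmoothForm_oneZeroForm fun x ↦ ?_
    have hev : localExpr (logDerivCoeffZ u) (chartAt ℂ x) =ᶠ[𝓝 (chartAt ℂ x x)]
        fun y ↦ (2 * π * I)⁻¹ * ((u ((chartAt ℂ x).symm y))⁻¹ * delAlong 1 (u ∘ (chartAt ℂ x).symm) y) := by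
      filter_upwards [(chartAt ℂ x).open_target.mem_nhds (mem_chart_target ℂ x)] with y hy
      exact localExpr_logDerivCoeffZ hy (differentiableAt_comp_symm_of_mem_target hu hy)
    refine ContDiffAt.congr_of_eventuallyEq ?_ hev
    have h := contDiffAt_inv_mul_delAlong (hu x) (by
      simp only [comp_apply, (chartAt ℂ x).left_inv (mem_chart_source ℂ x)]; exact h0 x)
    exact h
  have hQ : IsSmoothForm (zeroOneForm (logDerivCoeffZbar u)) := by
    refine isSmoothForm_zeroOneForm fun x ↦ ?_
    have hev : localExpr (star (logDerivCoeffZbar u)) (chartAt ℂ x) =ᶠ[𝓝 (chartAt ℂ x x)]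
        fun y ↦ conj ((2 * π * I)⁻¹ * ((u ((chartAt ℂ x).symm y))⁻¹ * dbarAlong 1 (u ∘ (chartAt ℂ x).symm) y)) := by
      filter_upwards [(chartAt ℂ x).open_target.mem_nhds (mem_chart_target ℂ x)] with y hy
      rw [← conj_localExpr_star_logDerivCoeffZbar hy (differentiableAt_comp_symm_of_mem_target hu hy), conj_conj]
    refine ContDiffAt.congr_of_eventuallyEq ?_ hev
    have h := contDiffAt_inv_mul_dbarAlong (hu x) (by
      simp only [comp_apply, (chartAt ℂ x).left_inv (mem_chart_source ℂ x)]; exact h0 x)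
    exact ((conjCLE : ℂ →L[ℝ] ℂ).contDiff.of_le le_top).contDiffAt.comp _ h
  exact hP.add hQ

end Smooth

/-! ### §5 Closedness: a local logarithm -/

section Closed

/-- **A holomorphic logarithm near a non-zero value**: `L(w) = log(w · w₀⁻¹) + log w₀` satisfies
`exp(L w) = w` and `L′(w) = w⁻¹` for `w` near `w₀ ≠ 0` (where `w w₀⁻¹` lies in the slit plane).
[cite: Forster1981, §20.4 (local logarithms of a weak solution)] -/
theorem hasDerivAt_localLog {w₀ w : ℂ} (hw₀ : w₀ ≠ 0) (hw : w * w₀⁻¹ ∈ slitPlane) :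
    HasDerivAt (fun w ↦ Complex.log (w * w₀⁻¹) + Complex.log w₀) w⁻¹ w := by
  have hw0 : w ≠ 0 := by
    rintro rfl; simp at hw
  have h1 : HasDerivAt (fun w ↦ w * w₀⁻¹) w₀⁻¹ w := by
    simpa using (hasDerivAt_id w).mul_const w₀⁻¹
  have h2 := (Complex.hasDerivAt_log hw).comp w h1
  have h3 := h2.add_const (Complex.log w₀)
  have h4 : (w * w₀⁻¹)⁻¹ * w₀⁻¹ = w⁻¹ := by
    rw [mul_inv, inv_inv, mul_assoc, mul_inv_cancel₀ hw₀, mul_one]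
  rw [h4] at h3
  exact h3

/-- Near `w₀ ≠ 0`, `w w₀⁻¹` lies in the slit plane. [cite: Forster1981, §20.4] -/
theorem eventually_mul_inv_mem_slitPlane {w₀ : ℂ} (hw₀ : w₀ ≠ 0) :
    ∀ᶠ w in 𝓝 w₀, w * w₀⁻¹ ∈ slitPlane := by
  have hc : ContinuousAt (fun w : ℂ ↦ w * w₀⁻¹) w₀ := (continuous_id.mul continuous_const).continuousAt
  have h1 : (fun w : ℂ ↦ w * w₀⁻¹) w₀ ∈ slitPlane := by
    simp only [mul_inv_cancel₀ hw₀]; exact one_mem_slitPlane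
  exact hc.eventually (isOpen_slitPlane.mem_nhds h1)

variable [IsManifold 𝓘(ℂ, ℂ) ω M] [IsManifold 𝓘(ℝ, ℂ) ∞ M]

/-- **The logarithmic differential is closed** (Forster 9.13 in a chart: near `z₀ = z_x x` write
`û = exp ∘ ℓ` with the smooth local logarithm `ℓ = L ∘ û`; then `û⁻¹ ∂û = ∂ℓ`, `û⁻¹ ∂̄û = ∂̄ℓ`, the
representative is `(2πi)⁻¹ (∂ℓ dz + ∂̄ℓ dz̄)` and `∂(∂̄ℓ) = ∂̄(∂ℓ)`).
[cite: Forster1981, §9.13 and §20.4] -/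
theorem isClosedForm_logDerivForm {u : M → ℂ}
    (hu : ∀ x, ContDiffAt ℝ ∞ (u ∘ (chartAt ℂ x).symm) (chartAt ℂ x x)) (h0 : ∀ x, u x ≠ 0) :
    IsClosedForm (logDerivForm u) := by
  have hsm := isSmoothForm_logDerivForm hu h0
  funext x
  set e := chartAt ℂ x with he
  set z₀ := e x with hz₀
  set û : ℂ → ℂ := u ∘ e.symm with hû
  have hûz₀ : û z₀ = u x := by simp [hû, hz₀, he, (chartAt ℂ x).left_inv (mem_chart_source ℂ x)]
  have hw₀ : û z₀ ≠ 0 := by rw [hûz₀]; exact h0 x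
  -- the local logarithm `ℓ = L ∘ û`
  set L : ℂ → ℂ := fun w ↦ Complex.log (w * (û z₀)⁻¹) + Complex.log (û z₀) with hL
  set ℓ : ℂ → ℂ := fun y ↦ L (û y) with hℓ
  have hûc : ContDiffAt ℝ ∞ û z₀ := hu x
  have hslit : ∀ᶠ y in 𝓝 z₀, û y * (û z₀)⁻¹ ∈ slitPlane :=
    hûc.continuousAt.eventually (eventually_mul_inv_mem_slitPlane hw₀)
  have htgt : ∀ᶠ y in 𝓝 z₀, y ∈ e.target := e.open_target.mem_nhds (mem_chart_target ℂ x)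
  have hûcn : ∀ᶠ y in 𝓝 z₀, ContDiffAt ℝ ∞ û y := by
    filter_upwards [htgt] with y hy using contDiffAt_comp_symm_of_mem_target hu hy
  -- `ℓ` is `C^∞` near `z₀`
  have hLc : ∀ {w : ℂ}, w * (û z₀)⁻¹ ∈ slitPlane → ContDiffAt ℝ ∞ L w := fun {w} hw ↦ by
    have h0 : ContDiffAt ℂ ∞ (fun w : ℂ ↦ w * (û z₀)⁻¹) w := contDiffAt_id.mul contDiffAt_const
    have h1 := (Complex.contDiffAt_log (n := ∞) hw).comp w h0
    exact ((h1.add contDiffAt_const).restrict_scalars ℝ)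
  have hℓc : ∀ᶠ y in 𝓝 z₀, ContDiffAt ℝ ∞ ℓ y := by
    filter_upwards [hslit, hûcn] with y hy hyc using (hLc hy).comp y hyc
  have hℓc₀ : ContDiffAt ℝ ∞ ℓ z₀ := hℓc.self_of_nhds
  -- `û⁻¹ ∂û = ∂ℓ` and `û⁻¹ ∂̄û = ∂̄ℓ` near `z₀`
  have hder : ∀ᶠ y in 𝓝 z₀, (û y)⁻¹ * delAlong 1 û y = delAlong 1 ℓ y ∧
      (û y)⁻¹ * dbarAlong 1 û y = dbarAlong 1 ℓ y := by
    filter_upwards [hslit, hûcn] with y hy hyc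
    have hLd : HasDerivAt L (û y)⁻¹ (û y) := hasDerivAt_localLog hw₀ hy
    have hyd : DifferentiableAt ℝ û y := hyc.differentiableAt (by simp)
    constructor
    · rw [hℓ, delAlong_one_comp_of_differentiableAt hLd.differentiableAt hyd, hLd.deriv]
    · rw [hℓ, dbarAlong_one_comp_of_differentiableAt hLd.differentiableAt hyd, hLd.deriv]
  -- the representative near `z₀`
  have heq : (logDerivForm u).inChart x =ᶠ[𝓝 z₀]
      fun y ↦ (((2 * π * I)⁻¹ * delAlong 1 ℓ y) • dzForm + ((2 * π * I)⁻¹ * dbarAlong 1 ℓ y) • dzbarForm :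
        ℂ [⋀^Fin 1]→L[ℝ] ℂ) := by
    filter_upwards [htgt, hder, hûcn] with y hy hyder hyc
    rw [inChart_logDerivForm hy (hyc.differentiableAt (by simp)), ← hyder.1, ← hyder.2]
    simp only [hû, he, comp_apply]
  -- differentiability of the coefficients and `∂Q = ∂̄P`
  have hdℓ : DifferentiableAt ℝ (delAlong 1 ℓ) z₀ := (contDiffAt_delAlong_one hℓc₀).differentiableAt (by simp)
  have hdbℓ : DifferentiableAt ℝ (dbarAlong 1 ℓ) z₀ := (contDiffAt_dbarAlong_one hℓc₀).differentiableAt (by simp)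
  have hP : DifferentiableAt ℝ (fun y ↦ (2 * π * I)⁻¹ * delAlong 1 ℓ y) z₀ := (differentiableAt_const _).mul hdℓ
  have hQ : DifferentiableAt ℝ (fun y ↦ (2 * π * I)⁻¹ * dbarAlong 1 ℓ y) z₀ := (differentiableAt_const _).mul hdbℓ
  have hPQ : delAlong 1 (fun y ↦ (2 * π * I)⁻¹ * dbarAlong 1 ℓ y) z₀ =
      dbarAlong 1 (fun y ↦ (2 * π * I)⁻¹ * delAlong 1 ℓ y) z₀ := by
    rw [delAlong_const_mul hdbℓ, dbarAlong_const_mul' hdℓ, delAlong_dbarAlong_comm hℓc₀ (WithTop.coe_le_coe.2 le_top)]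
  show mextDeriv (logDerivForm u) x = 0
  exact mextDeriv_eq_zero_of_inChart_eventuallyEq (mem_chart_source ℂ x) (hsm x) heq hP hQ hPQ

/-- The logarithmic differential is a smooth closed form. [cite: Forster1981, §9.13 and §20.4] -/
theorem logDerivForm_mem_cclosedSmoothForms {u : M → ℂ}
    (hu : ∀ x, ContDiffAt ℝ ∞ (u ∘ (chartAt ℂ x).symm) (chartAt ℂ x x)) (h0 : ∀ x, u x ≠ 0) :
    logDerivForm u ∈ cclosedSmoothForms ℂ M 1 :=
  mem_cclosedSmoothForms (isSmoothForm_logDerivForm hu h0) (isClosedForm_logDerivForm hu h0)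

end Closed

/-! ### §6 Reality for `|u| = 1` -/

section Unimodular

/-- For `|u| ≡ 1`: `conj(∂̄û(z₀)) = -u(x)⁻¹ u(x)⁻¹ ∂û(z₀)` in the preferred chart (differentiate
`û · conj û = 1` with `∂`: `∂û · ū + û · conj(∂̄û) = 0`, and `ū = u⁻¹`).
[cite: HormanderSCV1973, §1.1] [cite: Forster1981, §9.9] -/
theorem conj_dbarAlong_eq_of_norm_eq_one {u : M → ℂ} (h1 : ∀ x, ‖u x‖ = 1) {x : M}
    (hu : DifferentiableAt ℝ (u ∘ (chartAt ℂ x).symm) (chartAt ℂ x x)) :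
    conj (dbarAlong 1 (u ∘ (chartAt ℂ x).symm) (chartAt ℂ x x)) =
      -((u x)⁻¹ * ((u x)⁻¹ * delAlong 1 (u ∘ (chartAt ℂ x).symm) (chartAt ℂ x x))) := by
  set û := u ∘ (chartAt ℂ x).symm with hû
  set z₀ := chartAt ℂ x x with hz₀
  have hûz₀ : û z₀ = u x := by simp [hû, hz₀, (chartAt ℂ x).left_inv (mem_chart_source ℂ x)]
  have hux : u x ≠ 0 := by
    intro h; have := h1 x; rw [h, norm_zero] at this; exact zero_ne_one this
  -- `û · conj û = 1`
  have hconst : (fun y ↦ û y * conj (û y)) = fun _ ↦ (1 : ℂ) := by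
    funext y
    have hy1 : ‖û y‖ = 1 := h1 _
    rw [mul_conj, Complex.normSq_eq_norm_sq, hy1, one_pow, ofReal_one]
  have hd : delAlong 1 (fun y ↦ û y * conj (û y)) z₀ = 0 := by rw [hconst, delAlong_const']
  have hconjd : DifferentiableAt ℝ (fun y ↦ conj (û y)) z₀ :=
    (conjCLE : ℂ →L[ℝ] ℂ).differentiableAt.comp z₀ hu
  rw [delAlong_one_mul hu hconjd, delAlong_one_conj_comp hu, hûz₀] at hd
  have hinv : conj (u x) = (u x)⁻¹ := (Complex.inv_eq_conj (h1 x)).symm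
  rw [hinv] at hd
  have h := hd
  field_simp at h ⊢
  linear_combination h

/-- **For `|u| ≡ 1` the `(0,1)`-coefficient determines the `(1,0)`-coefficient: `conj Q = P`.**
[cite: Forster1981, §9.9 and §19.3] -/
theorem star_logDerivCoeffZbar_of_norm_eq_one {u : M → ℂ} (h1 : ∀ x, ‖u x‖ = 1)
    (hu : ∀ x, DifferentiableAt ℝ (u ∘ (chartAt ℂ x).symm) (chartAt ℂ x x)) :
    star (logDerivCoeffZbar u) = logDerivCoeffZ u := by
  funext x
  have hux : u x ≠ 0 := by
    intro h; have := h1 x; rw [h, norm_zero] at this; exact zero_ne_one this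
  have hinv : (u x)⁻¹ = conj (u x) := Complex.inv_eq_conj (h1 x)
  have hcu : conj ((u x)⁻¹) = u x := by rw [hinv, conj_conj]
  rw [Pi.star_apply, RCLike.star_def, logDerivCoeffZbar_apply, logDerivCoeffZ_apply, map_mul, map_mul,
    conj_dbarAlong_eq_of_norm_eq_one h1 (hu x), hcu, map_inv₀, map_mul, map_mul, conj_I, map_ofNat,
    conj_ofReal]
  field_simp

/-- Symmetric form: `conj P = Q` for `|u| ≡ 1`. [cite: Forster1981, §9.9 and §19.3] -/
theorem star_logDerivCoeffZ_of_norm_eq_one {u : M → ℂ} (h1 : ∀ x, ‖u x‖ = 1)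
    (hu : ∀ x, DifferentiableAt ℝ (u ∘ (chartAt ℂ x).symm) (chartAt ℂ x x)) :
    star (logDerivCoeffZ u) = logDerivCoeffZbar u := by
  rw [← star_logDerivCoeffZbar_of_norm_eq_one h1 hu, star_star]

/-- **For `|u| ≡ 1` the logarithmic differential is a REAL form: `conj((2πi)⁻¹ u⁻¹ du) = (2πi)⁻¹ u⁻¹ du`**
(it is `(2π)⁻¹ d arg u`). [cite: Forster1981, §19.3 and §20.4] -/
theorem conj_logDerivForm_of_norm_eq_one {u : M → ℂ} (h1 : ∀ x, ‖u x‖ = 1)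
    (hu : ∀ x, DifferentiableAt ℝ (u ∘ (chartAt ℂ x).symm) (chartAt ℂ x x)) :
    (logDerivForm u).conj = logDerivForm u := by
  rw [logDerivForm, MForm.conj_add, conj_oneZeroForm, conj_zeroOneForm, star_logDerivCoeffZ_of_norm_eq_one h1 hu,
    star_logDerivCoeffZbar_of_norm_eq_one h1 hu, add_comm]

end Unimodular

/-! ### §7 Unitisation `u/|u| = u · e^{-log|u|}` -/

section Unitize

/-- The real logarithm of the modulus, `log |u|`, as a complex-valued function. [cite: Forster1981, §20.4] -/
def logNorm (u : M → ℂ) (x : M) : ℂ := (Real.log ‖u x‖ : ℂ)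

/-- **The unitisation `u/|u| = u · e^{-log|u|}` of a nowhere-vanishing function.** [cite: Forster1981, §20.4] -/
def unitize (u : M → ℂ) (x : M) : ℂ := u x * exp (-logNorm u x)

omit [TopologicalSpace M] [ChartedSpace ℂ M] in
/-- `|u/|u|| = 1`. [cite: Forster1981, §20.4] -/
theorem norm_unitize {u : M → ℂ} (h0 : ∀ x, u x ≠ 0) (x : M) : ‖unitize u x‖ = 1 := by
  rw [unitize, logNorm, norm_mul, ← ofReal_neg, norm_exp_ofReal, Real.exp_neg,
    Real.exp_log (norm_pos_iff.2 (h0 x)), mul_inv_cancel₀ (norm_ne_zero_iff.2 (h0 x))]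

omit [TopologicalSpace M] [ChartedSpace ℂ M] in
/-- `u/|u| ≠ 0`. [cite: Forster1981, §20.4] -/
theorem unitize_ne_zero {u : M → ℂ} (h0 : ∀ x, u x ≠ 0) (x : M) : unitize u x ≠ 0 := by
  intro h; have := norm_unitize h0 x; rw [h, norm_zero] at this; exact zero_ne_one this

omit [ChartedSpace ℂ M] in
/-- `log |û|` is `C^∞` in a chart where `û` is `C^∞` and non-zero. [cite: Forster1981, §20.4] -/
theorem contDiffAt_logNorm_comp_symm {u : M → ℂ} {e : OpenPartialHomeomorph M ℂ} {y : ℂ}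
    (hu : ContDiffAt ℝ ∞ (u ∘ e.symm) y) (h0 : u (e.symm y) ≠ 0) :
    ContDiffAt ℝ ∞ (logNorm u ∘ e.symm) y := by
  have h1 : ContDiffAt ℝ ∞ (fun z ↦ ‖(u ∘ e.symm) z‖) y := hu.norm ℝ h0
  have h2 := (Real.contDiffAt_log.2 (norm_ne_zero_iff.2 h0)).comp y h1
  exact (Complex.ofRealCLM.contDiff.of_le le_top).contDiffAt.comp y h2

omit [ChartedSpace ℂ M] in
/-- `u/|u|` is `C^∞` in a chart where `u` is `C^∞` and non-zero. [cite: Forster1981, §20.4] -/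
theorem contDiffAt_unitize_comp_symm {u : M → ℂ} {e : OpenPartialHomeomorph M ℂ} {y : ℂ}
    (hu : ContDiffAt ℝ ∞ (u ∘ e.symm) y) (h0 : u (e.symm y) ≠ 0) :
    ContDiffAt ℝ ∞ (unitize u ∘ e.symm) y := by
  have h := hu.mul ((contDiffAt_logNorm_comp_symm hu h0).neg.cexp)
  exact h

variable [IsManifold 𝓘(ℝ, ℂ) ∞ M]

/-- **`logDerivForm (u/|u|) = logDerivForm u - (2πi)⁻¹ d(log|u|)`**: unitising a nowhere-vanishing
function changes its logarithmic differential by the EXACT form `(2πi)⁻¹ d log|u|`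
(`(u/|u|)⁻¹ d(u/|u|) = u⁻¹ du - d log|u|`). [cite: Forster1981, §20.4 and Theorem 20.7 (proof)] -/
theorem logDerivForm_unitize {u : M → ℂ}
    (hu : ∀ x, DifferentiableAt ℝ (u ∘ (chartAt ℂ x).symm) (chartAt ℂ x x)) (h0 : ∀ x, u x ≠ 0) :
    logDerivForm (unitize u) =
      logDerivForm u - (2 * π * I)⁻¹ • mextDeriv (MForm.ofFun 𝓘(ℝ, ℂ) (logNorm u)) := by
  funext x
  ext v
  set w : ℂ := v 0 with hw
  have hsx : (chartAt ℂ x).symm (chartAt ℂ x x) = x := (chartAt ℂ x).left_inv (mem_chart_source ℂ x)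
  have h0' : u ((chartAt ℂ x).symm (chartAt ℂ x x)) ≠ 0 := by rw [hsx]; exact h0 x
  have hux0 : u x ≠ 0 := h0 x
  -- differentiability of the pieces at `z₀ = z_x x`
  have hud : DifferentiableAt ℝ (u ∘ (chartAt ℂ x).symm) (chartAt ℂ x x) := hu x
  have hLd : DifferentiableAt ℝ (logNorm u ∘ (chartAt ℂ x).symm) (chartAt ℂ x x) := by
    have h1 : DifferentiableAt ℝ (fun z ↦ ‖(u ∘ (chartAt ℂ x).symm) z‖) (chartAt ℂ x x) := hud.norm ℝ h0'
    have h2 := (Real.differentiableAt_log (norm_ne_zero_iff.2 h0')).comp (chartAt ℂ x x) h1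
    exact Complex.ofRealCLM.differentiableAt.comp (chartAt ℂ x x) h2
  -- `D(u e^{-L}) = Du · e^{-L} + u e^{-L} · (-DL)`
  have hprod : fderiv ℝ (unitize u ∘ (chartAt ℂ x).symm) (chartAt ℂ x x) w =
      fderiv ℝ (u ∘ (chartAt ℂ x).symm) (chartAt ℂ x x) w * exp (-(logNorm u ∘ (chartAt ℂ x).symm) (chartAt ℂ x x)) +
        (u ∘ (chartAt ℂ x).symm) (chartAt ℂ x x) * (exp (-(logNorm u ∘ (chartAt ℂ x).symm) (chartAt ℂ x x)) *
          -(fderiv ℝ (logNorm u ∘ (chartAt ℂ x).symm) (chartAt ℂ x x) w)) := by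
    have hE : HasFDerivAt (fun z ↦ exp (-(logNorm u ∘ (chartAt ℂ x).symm) z))
        (exp (-(logNorm u ∘ (chartAt ℂ x).symm) (chartAt ℂ x x)) •
          -(fderiv ℝ (logNorm u ∘ (chartAt ℂ x).symm) (chartAt ℂ x x))) (chartAt ℂ x x) :=
      hLd.hasFDerivAt.neg.cexp
    have hP := hud.hasFDerivAt.mul hE
    have hfun : (unitize u ∘ (chartAt ℂ x).symm) =
        (u ∘ (chartAt ℂ x).symm) * fun z ↦ exp (-(logNorm u ∘ (chartAt ℂ x).symm) z) := by
      funext z; simp [unitize]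
    rw [hfun, hP.fderiv]
    simp only [add_apply, smul_apply, _root_.neg_apply, smul_eq_mul]
    ring
  rw [logDerivForm_apply, Pi.sub_apply, ContinuousAlternatingMap.sub_apply, logDerivForm_apply,
    Pi.smul_apply, ContinuousAlternatingMap.smul_apply, mextDeriv_ofFun_apply', smul_eq_mul]
  have hext : extChartAt 𝓘(ℝ, ℂ) x x = chartAt ℂ x x := by simp
  have hext' : (logNorm u ∘ (extChartAt 𝓘(ℝ, ℂ) x).symm) = logNorm u ∘ (chartAt ℂ x).symm := by
    funext y; simp
  rw [hext', hext, ← hw, hprod]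
  have hux : unitize u x = u x * exp (-(logNorm u ∘ (chartAt ℂ x).symm) (chartAt ℂ x x)) := by
    simp only [unitize, comp_apply, hsx]
  have huz : (u ∘ (chartAt ℂ x).symm) (chartAt ℂ x x) = u x := by simp only [comp_apply, hsx]
  rw [hux, huz]
  have hE0 : exp (-(logNorm u ∘ (chartAt ℂ x).symm) (chartAt ℂ x x)) ≠ 0 := exp_ne_zero _
  field_simp
  ring

omit [IsManifold 𝓘(ℝ, ℂ) ∞ M] in
/-- A function that is `C^∞` in every preferred chart is a smooth `0`-form. [cite: WarnerGTM94, 2.15] -/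
theorem isSmoothForm_ofFun_of_contDiffAt {f : M → ℂ}
    (hf : ∀ x, ContDiffAt ℝ ∞ (f ∘ (chartAt ℂ x).symm) (chartAt ℂ x x)) :
    IsSmoothForm (MForm.ofFun 𝓘(ℝ, ℂ) f) := by
  refine (isSmoothForm_iff_smoothAt _).2 fun x ↦ ?_
  rw [MForm.smoothAt_ofFun_iff, ModelWithCorners.Boundaryless.range_eq_univ, contDiffWithinAt_univ]
  have h1 : f ∘ (extChartAt 𝓘(ℝ, ℂ) x).symm = f ∘ (chartAt ℂ x).symm := by funext y; simp
  have h2 : extChartAt 𝓘(ℝ, ℂ) x x = chartAt ℂ x x := by simp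
  rw [h1, h2]
  exact hf x

omit [IsManifold 𝓘(ℝ, ℂ) ∞ M] in
/-- The correction `(2πi)⁻¹ d(log|u|)` is the differential of a smooth `0`-form.
[cite: Forster1981, §20.4] -/
theorem isSmoothForm_ofFun_logNorm {u : M → ℂ}
    (hu : ∀ x, ContDiffAt ℝ ∞ (u ∘ (chartAt ℂ x).symm) (chartAt ℂ x x)) (h0 : ∀ x, u x ≠ 0) :
    IsSmoothForm (MForm.ofFun 𝓘(ℝ, ℂ) (logNorm u)) := by
  refine isSmoothForm_ofFun_of_contDiffAt fun x ↦ ?_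
  exact contDiffAt_logNorm_comp_symm (e := chartAt ℂ x) (hu x) (by
    rw [(chartAt ℂ x).left_inv (mem_chart_source ℂ x)]; exact h0 x)

omit [IsManifold 𝓘(ℝ, ℂ) ∞ M] in
/-- `u/|u|` is `C^∞` in every preferred chart. [cite: Forster1981, §20.4] -/
theorem contDiffAt_unitize {u : M → ℂ}
    (hu : ∀ x, ContDiffAt ℝ ∞ (u ∘ (chartAt ℂ x).symm) (chartAt ℂ x x)) (h0 : ∀ x, u x ≠ 0) (x : M) :
    ContDiffAt ℝ ∞ (unitize u ∘ (chartAt ℂ x).symm) (chartAt ℂ x x) :=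
  contDiffAt_unitize_comp_symm (hu x) (by rw [(chartAt ℂ x).left_inv (mem_chart_source ℂ x)]; exact h0 x)

end Unitize

end RiemannSurface

end Literature.Geometry.Kaehler

end
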